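import Summits.AtomisticToContinuum.Crystallization.Theses.SpectralChargeLedger
import Summits.AtomisticToContinuum.Crystallization.Theorems.OneMultiplierPricing.Negative.BarlowShellDilation
import Summits.AtomisticToContinuum.Crystallization.Theorems.OneMultiplierPricing.Negative.Virial

/-!
# Disproof of `SummedShellPricing` (stmt-AtomisticToContinuum-17044, K1 of route `SpectralChargeLedger`) — findings

Standing disprover's work file (refuter, cdisprove seat, cycle 1).  Prose only in docstrings.

VERDICT (cycle 1): **no kill; the crux resists every Lean-certifiable attack for a structural reason**
(§6): a violating family must be certified to lie within `κ(τ)·(#bad/N)` of `e⋆ = ⨅_Q e(Q)` FROM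
BELOW, and the tree bounds `e⋆` from below only by stability constants (`-(2³²/12)`), from above by
trial states; the only configurations whose excess `E − N·e⋆` the tree controls are the ground states
`x^N` themselves (`o(N)`, `crysEnergyLimit`) and their images under maps whose energy change is
certified (dilations: the virial bound `𝓔((1+s)x) − 𝓔(x) ≤ 36 s² |𝓔(x)|`), and NOTHING is known
about the geometry of `x^N`.  Every lemma below is squeezed out of exactly that pair
(`x^N`, `(1+s)·x^N`) plus norm bookkeeping of the two reference shells.

CONTENTS
* §0  the crux parametrised: `Good`, `PricingClause`, `summedShellPricing_iff` (definitional);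
      monotonicity in `τ`, `κ`, `δ`.
* §1  reference-shell facts (both 12-shells have all norms `≤ ρ = max a₀ √(a₀²/3+h₀²) ≤ 1.01 a₀`,
      both attain `ρ` and `a₀`); `e⋆ ≤ −1/24`.
* §2  TIGHTNESS `kappa_le_of_pricingClause`: any admissible price satisfies
      `κ ≤ 324·(−e⋆)·(τ/a₀)²` for `τ ≤ 1/20` (dilated ground states; the constant cannot be linear).
* §3  REFUTED STRENGTHENINGS: uniform-in-`τ` price (`not_uniformKappa`), linear price
      (`not_linearKappa`, = the 17253 refutation in K1's clothes), exact shells `τ = 0`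
      (`summedShellPricing_false_without_tauPos`), "for ALL cells of the box"
      (`not_summedShellPricing_forall_cells`: the cells `a₀ = 47/50` and `a₀ = 1` cannot both be
      priced — the `∃ (a₀,h₀)` is pinned by the ground states).
* §4  LOAD-BEARING HYPOTHESES: `B ⊆ bad` (`summedShellPricing_false_without_bad`), injectivity /
      separation (`summedShellPricing_false_without_separation`, via the junk value `V_LJ(0) = 0`);
      NOT load-bearing: `τ ≤ 1` (`summedShellPricing_iff_noUpperTau`).
* §5  a positive consequence provers may quote: K1 at cell `c` forces `#bad_τ(x^N) = o(N)` at `c`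
      for every `τ` (`card_bad_le_of_pricingClause`) — K1 contains first-shell crystallization onto
      ONE relaxed Barlow cell.
* §6  `-- Line Sketch`: status of the lead's stubs and why `stub_torusCoercivity` is immune to all of
      the above (its allowance `C·#two-shell-bad` absorbs every ground-state witness); near-misses.

LANDING (importable twins under `Theorems/SummedShellPricing/Negative/`, DEF-FREE — the predicate and
the clause are scoped notations `Good⟪a₀, h₀, y, i, τ⟫`, `PC⟪δ, a₀, h₀, τ, κ⟫` expanding to the
verbatim crux terms; open namespace `…Theorems.SummedShellPricing.Negative` to use them):
part I `PricingClause.lean` (§0–§2: `summedShellPricing_iff`, monotonicity, shell norms, `eStar_le_neg`,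
`not_good_dilate_of_good`, `kappa_le_of_pricingClause`) = p169997, ACCEPTED 2026-08-17T16:24Z (review:
notation flag cleared); part II `Strengthenings.lean` (§3: `kappa_nonpos_of_pricingClause_zero`,
`exists_tau_lt`, `not_uniformKappa`, `not_linearKappa`, `summedShellPricing_false_without_tauPos`) = p170950
and part III `Cells.lean` (§3 cells `not_good_of_good_of_cells`, `not_pricingClause_two_cells`,
`not_summedShellPricing_forall_cells`; §4 `summedShellPricing_false_without_bad`,
`summedShellPricing_false_without_separation`, `summedShellPricing_iff_noUpperTau`; §5
`card_bad_le_of_pricingClause`) = p171011, both ACCEPTED 2026-08-17 (commits 587cd10c4b47,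
486f167e8279; rc 0, 0 warnings, standard axioms).  Import `Summits.AtomisticToContinuum.Crystallization.Theorems.SummedShellPricing.Negative.Cells`
(resp. `.Strengthenings`) to use them; this work file keeps its self-contained def-based twins.
-/

noncomputable section

namespace Summit.AtomisticToContinuum.Crystallization.Cruxes.SummedShellPricing.Disproof

open scoped BigOperators
open Literature.MathematicalPhysics.StatisticalMechanics
open Summit.AtomisticToContinuum.Crystallization.Theorems.ChargedEnergyGapNegative
  (E3 eStar card_mul_eStar_le eStar_le_groundStateEnergy_div crysEnergyLimit groundStateEnergy_nonpos)
open Summit.AtomisticToContinuum.Crystallization.Theorems.OneMultiplierPricing.Negative.BarlowShellDilation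
open Summit.AtomisticToContinuum.Crystallization.Theorems.OneMultiplierPricing.Negative.Virial
open Summit.AtomisticToContinuum.Crystallization.Theses.SpectralChargeLedger (SummedShellPricing)

/-! ## §0 The crux, parametrised -/

/-- The punctured open `13/10·a₀`-shell of site `i` of `y` (verbatim the crux's set). [folklore] -/
def shell (a₀ : ℝ) {N : ℕ} (y : Fin N → E3) (i : Fin N) : Set E3 :=
  {z : E3 | z ∈ Set.range y ∧ z ≠ y i ∧ dist z (y i) < 13 / 10 * a₀}

/-- The relaxed hcp reference 12-shell at cell `(a₀, h₀)` (verbatim). [folklore] -/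
def hcpShell (a₀ h₀ : ℝ) : Set E3 :=
  {p : E3 | p ∈ hcpStacking a₀ h₀ ∧ p ≠ 0 ∧ ‖p‖ < 13 / 10 * a₀}

/-- The relaxed fcc reference 12-shell at cell `(a₀, h₀)` (verbatim). [folklore] -/
def fccShell (a₀ h₀ : ℝ) : Set E3 :=
  {p : E3 | p ∈ fccStacking a₀ h₀ ∧ p ≠ 0 ∧ ‖p‖ < 13 / 10 * a₀}

/-- `τ`-matching of the shell of site `i` to a pattern set `T` after the linear isometry `A`. [folklore] -/
def MatchedTo (a₀ : ℝ) {N : ℕ} (y : Fin N → E3) (i : Fin N) (T : Set E3) (A : E3 →ₗᵢ[ℝ] E3)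
    (τ : ℝ) : Prop :=
  ∃ e : ↥(shell a₀ y i) ≃ ↥T, ∀ t : ↥(shell a₀ y i), dist ((t : E3) - y i) (A ((e t : ↥T) : E3)) ≤ τ

/-- `τ`-goodness of site `i` at cell `(a₀, h₀)`: the crux's matching predicate, verbatim. [folklore] -/
def Good (a₀ h₀ : ℝ) {N : ℕ} (y : Fin N → E3) (i : Fin N) (τ : ℝ) : Prop :=
  ∃ A : E3 →ₗᵢ[ℝ] E3, MatchedTo a₀ y i (hcpShell a₀ h₀) A τ ∨ MatchedTo a₀ y i (fccShell a₀ h₀) A τ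

/-- The pricing clause of the crux at separation `δ`, cell `(a₀,h₀)`, tolerance `τ`, price `κ`
(the inner `∀ N y B` of `SummedShellPricing`). [folklore] -/
def PricingClause (δ a₀ h₀ τ κ : ℝ) : Prop :=
  ∀ (N : ℕ) (y : Fin N → E3), (∀ i j : Fin N, i ≠ j → δ ≤ dist (y i) (y j)) →
    ∀ B : Finset (Fin N), (∀ i ∈ B, ¬ Good a₀ h₀ y i τ) →
      κ * (B.card : ℝ) ≤ interactionEnergy lennardJones y - (N : ℝ) * eStar

/-- The relaxed-Barlow box of the route. [folklore] -/
def InBox (a₀ h₀ : ℝ) : Prop :=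
  47 / 50 ≤ a₀ ∧ a₀ ≤ 1 ∧ |h₀ - a₀ * Real.sqrt (2 / 3)| ≤ a₀ / 100

/-- **The crux IS `∀ δ > 0, ∃ cell in the box, ∀ τ ∈ (0,1], ∃ κ > 0, PricingClause δ a₀ h₀ τ κ`**
(definitionally). [folklore] -/
theorem summedShellPricing_iff :
    SummedShellPricing ↔ ∀ δ : ℝ, 0 < δ → ∃ a₀ h₀ : ℝ, 47 / 50 ≤ a₀ ∧ a₀ ≤ 1 ∧
      |h₀ - a₀ * Real.sqrt (2 / 3)| ≤ a₀ / 100 ∧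
      ∀ τ : ℝ, 0 < τ → τ ≤ 1 → ∃ κ : ℝ, 0 < κ ∧ PricingClause δ a₀ h₀ τ κ :=
  Iff.rfl

/-- Goodness is an up-set in the tolerance (same isometry, same bijection). [folklore] -/
theorem good_mono {a₀ h₀ : ℝ} {N : ℕ} {y : Fin N → E3} {i : Fin N} {τ τ' : ℝ} (hτ : τ ≤ τ')
    (h : Good a₀ h₀ y i τ) : Good a₀ h₀ y i τ' := by
  obtain ⟨A, ⟨e, he⟩ | ⟨e, he⟩⟩ := h
  · exact ⟨A, Or.inl ⟨e, fun t => (he t).trans hτ⟩⟩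
  · exact ⟨A, Or.inr ⟨e, fun t => (he t).trans hτ⟩⟩

/-- The pricing clause is monotone in `τ`: a larger tolerance has fewer bad sites. [folklore] -/
theorem pricingClause_mono_tau {δ a₀ h₀ τ τ' κ : ℝ} (hτ : τ ≤ τ') (h : PricingClause δ a₀ h₀ τ κ) :
    PricingClause δ a₀ h₀ τ' κ :=
  fun N y hsep B hB => h N y hsep B fun i hi hg => hB i hi (good_mono hτ hg)

/-- The pricing clause is antitone in `κ`. [folklore] -/
theorem pricingClause_mono_kappa {δ a₀ h₀ τ κ κ' : ℝ} (hκ : κ' ≤ κ) (h : PricingClause δ a₀ h₀ τ κ) :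
    PricingClause δ a₀ h₀ τ κ' :=
  fun N y hsep B hB => (mul_le_mul_of_nonneg_right hκ (Nat.cast_nonneg _)).trans (h N y hsep B hB)

/-- The pricing clause is monotone in `δ`: a larger separation admits fewer configurations. [folklore] -/
theorem pricingClause_mono_delta {δ δ' a₀ h₀ τ κ : ℝ} (hδ : δ ≤ δ') (h : PricingClause δ a₀ h₀ τ κ) :
    PricingClause δ' a₀ h₀ τ κ :=
  fun N y hsep B hB => h N y (fun i j hij => hδ.trans (hsep i j hij)) B hB

/-! ## §1 Reference-shell facts and the sign of `e⋆` -/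

/-- `ρ = max a₀ √(a₀²/3+h₀²) ≤ 1.01·a₀` on the box. [folklore] -/
theorem rho_le {a₀ h₀ : ℝ} (ha : 47 / 50 ≤ a₀) (hh : |h₀ - a₀ * Real.sqrt (2 / 3)| ≤ a₀ / 100) :
    max a₀ (Real.sqrt (a₀ ^ 2 / 3 + h₀ ^ 2)) ≤ 101 / 100 * a₀ := by
  have ha0 : 0 < a₀ := by linarith
  have hs23 : Real.sqrt (2 / 3) < 817 / 1000 := by
    rw [show (817 : ℝ) / 1000 = Real.sqrt ((817 / 1000) ^ 2) by rw [Real.sqrt_sq (by norm_num)]]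
    exact Real.sqrt_lt_sqrt (by norm_num) (by norm_num)
  have hs23' : (4 : ℝ) / 5 < Real.sqrt (2 / 3) := by
    rw [show (4 : ℝ) / 5 = Real.sqrt ((4 / 5) ^ 2) by rw [Real.sqrt_sq (by norm_num)]]
    exact Real.sqrt_lt_sqrt (by norm_num) (by norm_num)
  have hhhi : h₀ ≤ 827 / 1000 * a₀ := by
    have h1 := (abs_le.1 hh).2
    have h2 := mul_lt_mul_of_pos_left hs23 ha0
    linarith only [h1, h2]
  have hhlo : 79 / 100 * a₀ ≤ h₀ := by
    have h1 := (abs_le.1 hh).1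
    have h2 := mul_lt_mul_of_pos_left hs23' ha0
    linarith only [h1, h2]
  refine max_le (by linarith only [ha0]) ?_
  rw [show (101 : ℝ) / 100 * a₀ = Real.sqrt ((101 / 100 * a₀) ^ 2) by
    rw [Real.sqrt_sq (by positivity)]]
  exact Real.sqrt_le_sqrt (by nlinarith only [hhhi, hhlo, ha0])

/-- Every point of either reference shell has norm `≤ ρ`. [folklore] -/
theorem norm_le_rho_of_mem {a₀ h₀ : ℝ} (ha : 47 / 50 ≤ a₀) (hh : |h₀ - a₀ * Real.sqrt (2 / 3)| ≤ a₀ / 100)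
    {p : E3} (hp : p ∈ hcpShell a₀ h₀ ∨ p ∈ fccShell a₀ h₀) :
    ‖p‖ ≤ max a₀ (Real.sqrt (a₀ ^ 2 / 3 + h₀ ^ 2)) := by
  rcases hp with ⟨hp, -, hpn⟩ | ⟨hp, -, hpn⟩
  · exact norm_le_of_mem_barlowStacking ha hh isHaggSeq_alternating hp hpn
  · exact norm_le_of_mem_barlowStacking ha hh isHaggSeq_const hp hpn

/-- Both reference shells contain a point of norm exactly `ρ` (the dilation lever). [folklore] -/
theorem exists_mem_norm_eq_rho {a₀ h₀ : ℝ} (ha : 47 / 50 ≤ a₀)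
    (hh : |h₀ - a₀ * Real.sqrt (2 / 3)| ≤ a₀ / 100) {s : ℤ → ℤ} (hs : IsHaggSeq s) :
    ∃ p ∈ {p : E3 | p ∈ barlowStacking a₀ h₀ s ∧ p ≠ 0 ∧ ‖p‖ < 13 / 10 * a₀},
      ‖p‖ = max a₀ (Real.sqrt (a₀ ^ 2 / 3 + h₀ ^ 2)) := by
  have ha0 : 0 < a₀ := by linarith
  have hρle := rho_le ha hh
  set b₀ : ℝ := Real.sqrt (a₀ ^ 2 / 3 + h₀ ^ 2) with hb₀
  rcases le_total b₀ a₀ with hab | hab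
  · have hρeq : max a₀ b₀ = a₀ := max_eq_left hab
    refine ⟨barlowPos a₀ h₀ s 0 1 0, ⟨barlowPos_mem 0 1 0, ?_, ?_⟩, ?_⟩
    · intro h0
      have h1 := norm_barlowPos_010 ha0.le h₀ s
      rw [h0, norm_zero] at h1
      linarith only [h1, ha0]
    · rw [norm_barlowPos_010 ha0.le h₀ s]; linarith only [ha0]
    · rw [norm_barlowPos_010 ha0.le h₀ s, hρeq]
  · have hρeq : max a₀ b₀ = b₀ := max_eq_right hab
    refine ⟨barlowPos a₀ h₀ s 1 0 0, ⟨barlowPos_mem 1 0 0, ?_, ?_⟩, ?_⟩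
    · intro h0
      have h1 := norm_barlowPos_100 (a := a₀) (h := h₀) hs
      rw [h0, norm_zero] at h1
      have h2 : b₀ = 0 := by rw [hb₀]; exact h1.symm
      linarith only [h2, hab, ha0]
    · rw [norm_barlowPos_100 hs, ← hb₀]
      have : max a₀ b₀ ≤ 101 / 100 * a₀ := hρle
      rw [hρeq] at this
      linarith only [this, ha0]
    · rw [norm_barlowPos_100 hs, ← hb₀, hρeq]

/-- Both reference shells contain the in-layer neighbour `(a₀, 0, 0)` of norm exactly `a₀`
(the two-cells lever). [folklore] -/
theorem exists_mem_norm_eq_a {a₀ h₀ : ℝ} (ha0 : 0 < a₀) (s : ℤ → ℤ) :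
    ∃ p ∈ {p : E3 | p ∈ barlowStacking a₀ h₀ s ∧ p ≠ 0 ∧ ‖p‖ < 13 / 10 * a₀}, ‖p‖ = a₀ := by
  refine ⟨barlowPos a₀ h₀ s 0 1 0, ⟨barlowPos_mem 0 1 0, ?_, ?_⟩, norm_barlowPos_010 ha0.le h₀ s⟩
  · intro h0
    have h1 := norm_barlowPos_010 ha0.le h₀ s
    rw [h0, norm_zero] at h1
    linarith only [h1, ha0]
  · rw [norm_barlowPos_010 ha0.le h₀ s]; linarith only [ha0]

/-- The energy of a two-point configuration. [folklore] -/
theorem interactionEnergy_two (V : ℝ → ℝ) (a b : E3) : interactionEnergy V ![a, b] = V (dist a b) := by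
  unfold interactionEnergy
  have h0 : Finset.Ioi (0 : Fin 2) = {1} := by decide
  have h1 : Finset.Ioi (1 : Fin 2) = ∅ := by decide
  simp [Fin.sum_univ_two, h0, h1]

/-- **`e⋆ ≤ −1/24 < 0`** (the dimer at distance `1` has energy `V_LJ(1) = −1/12`, and
`2 e⋆ ≤ E(2)`). [folklore] -/
theorem eStar_le_neg : eStar ≤ -(1 / 24) := by
  set b : E3 := barlowPos 1 0 constHagg 0 1 0 with hb
  have hdist : dist (0 : E3) b = 1 := by
    rw [dist_eq_norm, zero_sub, norm_neg, hb, norm_barlowPos_010 zero_le_one]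
  have hinj : Function.Injective ![(0 : E3), b] := by
    intro i j hij
    fin_cases i <;> fin_cases j
    · rfl
    · exfalso
      have h : (0 : E3) = b := hij
      have := hdist; rw [h, dist_self] at this; exact zero_ne_one this
    · exfalso
      have h : b = (0 : E3) := hij
      have := hdist; rw [h, dist_self] at this; exact zero_ne_one this
    · rfl
  have h1 := card_mul_eStar_le hinj
  rw [interactionEnergy_two, hdist, lennardJones_one] at h1
  norm_num at h1
  linarith

/-- `0 < −e⋆`. [folklore] -/
theorem neg_eStar_pos : 0 < -eStar := by linarith [eStar_le_neg]

/-! ## §2 Tightness: any admissible price is `O(τ²)` (dilated ground states)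

The device of the 17253 refutation, run against the summed crux: a site of `x` that is `τ`-good at
scale `1` is `τ`-BAD in the uniform dilate `(1+s)·x` once `s·ρ > 2τ` (take `s = 3τ/ρ`), because the
preimage of a reference point of maximal norm `ρ` is carried to norm `≥ (1+s)(ρ−τ) > ρ + τ`, out of
reach of every reference point; so EVERY site is `τ`-bad in `x` or in `(1+s)x`.  For a ground state
`x = x^N`: `𝓔(x) − N e⋆ = o(N)` (`crysEnergyLimit`) and `𝓔((1+s)x) − 𝓔(x) ≤ 36 s²·(−𝓔(x))`
(virial identity), `−𝓔(x)/N → −e⋆`.  Summing the clause over both configurations: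
`κ N ≤ o(N) + 36 s² (−e⋆ + o(1)) N`, i.e. `κ ≤ 324 (−e⋆) τ²/ρ² ≤ 324 (−e⋆) (τ/a₀)²`. -/

/-- **Dilation covering.** For `0 < τ ≤ 1/20`, a cell of the box and `s = 3τ/ρ`: a `τ`-good site of
`y` is `τ`-bad in `(1+s)•y`. [folklore] -/
theorem not_good_dilate_of_good {a₀ h₀ : ℝ} (ha : 47 / 50 ≤ a₀)
    (hh : |h₀ - a₀ * Real.sqrt (2 / 3)| ≤ a₀ / 100) {τ : ℝ} (hτ : 0 < τ) (hτ' : τ ≤ 1 / 20)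
    {N : ℕ} (y : Fin N → E3) (i : Fin N) (hg : Good a₀ h₀ y i τ) :
    ¬ Good a₀ h₀ (fun l => (1 + 3 * τ / max a₀ (Real.sqrt (a₀ ^ 2 / 3 + h₀ ^ 2))) • y l) i τ := by
  intro hg'
  have ha0 : 0 < a₀ := by linarith
  set ρ : ℝ := max a₀ (Real.sqrt (a₀ ^ 2 / 3 + h₀ ^ 2)) with hρ
  have hρa : a₀ ≤ ρ := le_max_left _ _
  have hρ0 : 0 < ρ := lt_of_lt_of_le ha0 hρa
  have hρle : ρ ≤ 101 / 100 * a₀ := rho_le ha hh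
  set s : ℝ := 3 * τ / ρ with hs
  have hs0 : 0 ≤ s := by positivity
  have hfit : (1 + s) * (ρ + τ) < 13 / 10 * a₀ := by
    have hexp : (1 + s) * (ρ + τ) = ρ + 4 * τ + 3 * τ ^ 2 / ρ := by
      rw [hs]; field_simp; ring
    have h3 : 3 * τ ^ 2 / ρ ≤ 1 / 100 := by
      rw [div_le_iff₀ hρ0]; nlinarith
    rw [hexp]; nlinarith
  have hF1 : ∀ p : E3, (p ∈ hcpShell a₀ h₀ ∨ p ∈ fccShell a₀ h₀) → ‖p‖ ≤ ρ :=
    fun p hp => norm_le_rho_of_mem ha hh hp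
  have hdef : (1 + s) * (ρ - τ) - ρ ≤ τ := by
    obtain ⟨A, ⟨e, he⟩ | ⟨e, he⟩⟩ := hg <;> obtain ⟨A', ⟨e', he'⟩ | ⟨e', he'⟩⟩ := hg'
    · exact dilation_defect y i _ _ (exists_mem_norm_eq_rho ha hh isHaggSeq_alternating)
        (fun p hp => hF1 p (Or.inl hp)) hs0 hfit A e he A' e' he'
    · exact dilation_defect y i _ _ (exists_mem_norm_eq_rho ha hh isHaggSeq_alternating)
        (fun p hp => hF1 p (Or.inr hp)) hs0 hfit A e he A' e' he'
    · exact dilation_defect y i _ _ (exists_mem_norm_eq_rho ha hh isHaggSeq_const)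
        (fun p hp => hF1 p (Or.inl hp)) hs0 hfit A e he A' e' he'
    · exact dilation_defect y i _ _ (exists_mem_norm_eq_rho ha hh isHaggSeq_const)
        (fun p hp => hF1 p (Or.inr hp)) hs0 hfit A e he A' e' he'
  have hexp : (1 + s) * (ρ - τ) - ρ = 2 * τ - 3 * τ ^ 2 / ρ := by
    rw [hs]; field_simp; ring
  have h3 : 3 * τ ^ 2 / ρ < τ := by
    rw [div_lt_iff₀ hρ0]; nlinarith
  linarith

/-- **TIGHTNESS of the crux: `κ(τ) ≤ 324·(−e⋆)·(τ/a₀)²` for `0 < τ ≤ 1/20`.**  If every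
Lennard-Jones ground state is `δ`-separated (true for the `δ` of `LennardJonesMinimalDistance_holds`,
and for every smaller `δ`), then at any cell of the box a price `κ` admissible in the pricing clause at
tolerance `τ` is at most `324 (−e⋆) (τ/a₀)²` (`≈ 250 τ²` at `e⋆ ≈ −0.7176`, `a₀ ≈ 0.971`; numerics of
the ideators put the true binding family — one displaced atom — at `1.4 τ²`).  Witness: the ground
states and their dilates by `1 + 3τ/ρ`. [folklore] -/
theorem kappa_le_of_pricingClause {δ : ℝ}
    (hδGS : ∀ (N : ℕ) (x : Fin N → E3), IsGroundState lennardJones x →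
      ∀ i j : Fin N, i ≠ j → δ ≤ dist (x i) (x j))
    {a₀ h₀ : ℝ} (ha : 47 / 50 ≤ a₀) (hh : |h₀ - a₀ * Real.sqrt (2 / 3)| ≤ a₀ / 100)
    {τ : ℝ} (hτ : 0 < τ) (hτ' : τ ≤ 1 / 20) {κ : ℝ} (hP : PricingClause δ a₀ h₀ τ κ) :
    κ ≤ 324 * (-eStar) * (τ / a₀) ^ 2 := by
  classical
  by_contra hcon
  push Not at hcon
  have ha0 : 0 < a₀ := by linarith
  set ρ : ℝ := max a₀ (Real.sqrt (a₀ ^ 2 / 3 + h₀ ^ 2)) with hρ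
  have hρa : a₀ ≤ ρ := le_max_left _ _
  have hρ0 : 0 < ρ := lt_of_lt_of_le ha0 hρa
  set s : ℝ := 3 * τ / ρ with hs
  have hs0 : 0 < s := by positivity
  -- the constant `L = 324 (τ/a₀)² ≥ 36 s²`
  set L : ℝ := 324 * (τ / a₀) ^ 2 with hL
  have hL0 : 0 ≤ L := by positivity
  have hsL : 36 * s ^ 2 ≤ L := by
    have h1 : τ / ρ ≤ τ / a₀ := div_le_div_of_nonneg_left hτ.le ha0 hρa
    have h2 : 0 ≤ τ / ρ := by positivity
    have h3 : 36 * s ^ 2 = 324 * (τ / ρ) ^ 2 := by rw [hs]; ring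
    rw [h3, hL]
    nlinarith [mul_self_le_mul_self h2 h1]
  have hcon' : L * (-eStar) < κ := by rw [hL]; linarith
  -- the slack `θ`
  set θ : ℝ := (κ - L * (-eStar)) / (2 + L) with hθ
  have hθ0 : 0 < θ := div_pos (by linarith) (by linarith)
  have hθid : (2 + L) * θ = κ - L * (-eStar) := by
    rw [hθ]; field_simp
  -- a large `N`: `𝓔(N) < (e⋆ + θ) N` and `𝓔(N) > (e⋆ − θ) N`
  have hEL : Filter.Tendsto (fun N : ℕ => groundStateEnergy lennardJones 3 N / (N : ℝ)) Filter.atTop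
      (nhds eStar) := crysEnergyLimit
  have hev1 : ∀ᶠ N : ℕ in Filter.atTop, groundStateEnergy lennardJones 3 N / (N : ℝ) < eStar + θ :=
    (tendsto_order.1 hEL).2 _ (lt_add_of_pos_right _ hθ0)
  have hev2 : ∀ᶠ N : ℕ in Filter.atTop, eStar - θ < groundStateEnergy lennardJones 3 N / (N : ℝ) :=
    (tendsto_order.1 hEL).1 _ (by linarith)
  obtain ⟨N, hN1, hN2, hN3⟩ := (hev1.and (hev2.and (Filter.eventually_ge_atTop 1))).exists
  have hNpos : (0 : ℝ) < N := by exact_mod_cast hN3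
  have hEup : groundStateEnergy lennardJones 3 N < (eStar + θ) * N := (div_lt_iff₀ hNpos).1 hN1
  have hElo : (eStar - θ) * N < groundStateEnergy lennardJones 3 N := (lt_div_iff₀ hNpos).1 hN2
  have hE0 : 0 ≤ -groundStateEnergy lennardJones 3 N := by linarith [groundStateEnergy_nonpos N]
  -- the ground state and its dilate
  obtain ⟨x, hx⟩ := LennardJonesGroundStatesExist_holds N
  have hsep : ∀ i j : Fin N, i ≠ j → δ ≤ dist (x i) (x j) := hδGS N x hx
  have hs1 : (0 : ℝ) < 1 + s := by linarith
  set x' : Fin N → E3 := fun l => (1 + s) • x l with hx'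
  have hsep' : ∀ i j : Fin N, i ≠ j → δ ≤ dist (x' i) (x' j) := by
    intro i j hij
    have h1 := hsep i j hij
    show δ ≤ dist ((1 + s) • x i) ((1 + s) • x j)
    rw [dist_smul₀, Real.norm_eq_abs, abs_of_pos hs1]
    exact h1.trans (le_mul_of_one_le_left dist_nonneg (by linarith))
  -- the clause summed over both configurations
  set B₁ : Finset (Fin N) := Finset.univ.filter (fun i : Fin N => ¬ Good a₀ h₀ x i τ) with hB₁
  set B₂ : Finset (Fin N) := Finset.univ.filter (fun i : Fin N => ¬ Good a₀ h₀ x' i τ) with hB₂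
  have hS1 := hP N x hsep B₁ (fun i hi => (Finset.mem_filter.1 hi).2)
  have hS2 := hP N x' hsep' B₂ (fun i hi => (Finset.mem_filter.1 hi).2)
  rw [hx.2] at hS1
  have hdil := interactionEnergy_dilate_le hx hs0.le
  rw [hx.2] at hdil
  -- every site is bad in `x` or in `x'`
  have hcover : (Finset.univ : Finset (Fin N)) ⊆ B₁ ∪ B₂ := by
    intro i _
    rw [Finset.mem_union, hB₁, hB₂, Finset.mem_filter, Finset.mem_filter]
    by_cases hg : Good a₀ h₀ x i τ
    · exact Or.inr ⟨Finset.mem_univ _, not_good_dilate_of_good ha hh hτ hτ' x i hg⟩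
    · exact Or.inl ⟨Finset.mem_univ _, hg⟩
  have hcount : (N : ℝ) ≤ (B₁.card : ℝ) + (B₂.card : ℝ) := by
    have h1 := (Finset.card_le_card hcover).trans (Finset.card_union_le _ _)
    rw [Finset.card_univ, Fintype.card_fin] at h1
    exact_mod_cast h1
  -- arithmetic
  have hb1 : κ * (B₁.card : ℝ) < θ * N := by nlinarith [hS1, hEup]
  have h36 : 36 * s ^ 2 * (-groundStateEnergy lennardJones 3 N) ≤ L * ((θ - eStar) * N) := by
    calc 36 * s ^ 2 * (-groundStateEnergy lennardJones 3 N)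
        ≤ L * (-groundStateEnergy lennardJones 3 N) := mul_le_mul_of_nonneg_right hsL hE0
      _ ≤ L * ((θ - eStar) * N) := mul_le_mul_of_nonneg_left (by linarith) hL0
  have hb2 : κ * (B₂.card : ℝ) < θ * N + L * ((θ - eStar) * N) := by
    have : interactionEnergy lennardJones x' - (N : ℝ) * eStar
        ≤ groundStateEnergy lennardJones 3 N - (N : ℝ) * eStar
          + 36 * s ^ 2 * (-groundStateEnergy lennardJones 3 N) := by linarith
    nlinarith [hS2, this, h36, hEup]
  have hκ0 : 0 < κ := lt_of_le_of_lt (mul_nonneg hL0 neg_eStar_pos.le) hcon'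
  have hsum : κ * (N : ℝ) < (2 * θ + L * (θ - eStar)) * N := by
    have := mul_le_mul_of_nonneg_left hcount hκ0.le
    nlinarith [this, hb1, hb2]
  have hfin : κ < 2 * θ + L * (θ - eStar) := lt_of_mul_lt_mul_right hsum hNpos.le
  nlinarith [hfin, hθid]

/-- At `τ = 0` (exact shells) no positive price is admissible: `κ ≤ 0`. [folklore] -/
theorem kappa_nonpos_of_pricingClause_zero {δ : ℝ}
    (hδGS : ∀ (N : ℕ) (x : Fin N → E3), IsGroundState lennardJones x →
      ∀ i j : Fin N, i ≠ j → δ ≤ dist (x i) (x j))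
    {a₀ h₀ : ℝ} (ha : 47 / 50 ≤ a₀) (hh : |h₀ - a₀ * Real.sqrt (2 / 3)| ≤ a₀ / 100)
    {κ : ℝ} (hP : PricingClause δ a₀ h₀ 0 κ) : κ ≤ 0 := by
  by_contra hcon
  push Not at hcon
  have ha0 : 0 < a₀ := by linarith
  -- `τ := min (1/20) (κ a₀² / (648 (−e⋆)))`-type choice, packaged in `exists_tau_lt` below; inline:
  set M : ℝ := 324 * (-eStar) / a₀ ^ 2 with hM
  have hM0 : 0 ≤ M := div_nonneg (mul_nonneg (by norm_num) neg_eStar_pos.le) (by positivity)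
  set τ : ℝ := min (1 / 20) (κ / (2 * (M + 1))) with hτ
  have hτ0 : 0 < τ := lt_min (by norm_num) (div_pos hcon (by positivity))
  have hτ1 : τ ≤ 1 / 20 := min_le_left _ _
  have hτ2 : τ ≤ κ / (2 * (M + 1)) := min_le_right _ _
  have hle := kappa_le_of_pricingClause hδGS ha hh hτ0 hτ1 (pricingClause_mono_tau hτ0.le hP)
  have hid : 324 * (-eStar) * (τ / a₀) ^ 2 = M * τ ^ 2 := by rw [hM]; field_simp
  rw [hid] at hle
  have hτsq : τ ^ 2 ≤ τ := by nlinarith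
  have h1 : M * τ ^ 2 ≤ M * τ := mul_le_mul_of_nonneg_left hτsq hM0
  have h2 : M * τ ≤ M * (κ / (2 * (M + 1))) := mul_le_mul_of_nonneg_left hτ2 hM0
  have h3 : M * (κ / (2 * (M + 1))) < κ := by
    rw [mul_div_assoc', div_lt_iff₀ (by positivity)]
    nlinarith
  linarith

/-- A tolerance small against a given positive price. [folklore] -/
theorem exists_tau_lt {κ a₀ : ℝ} (hκ : 0 < κ) (ha0 : 0 < a₀) :
    ∃ τ : ℝ, 0 < τ ∧ τ ≤ 1 / 20 ∧ 324 * (-eStar) * (τ / a₀) ^ 2 < κ := by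
  set M : ℝ := 324 * (-eStar) / a₀ ^ 2 with hM
  have hM0 : 0 ≤ M := div_nonneg (mul_nonneg (by norm_num) neg_eStar_pos.le) (by positivity)
  set τ : ℝ := min (1 / 20) (κ / (2 * (M + 1))) with hτ
  have hτ0 : 0 < τ := lt_min (by norm_num) (div_pos hκ (by positivity))
  have hτ1 : τ ≤ 1 / 20 := min_le_left _ _
  have hτ2 : τ ≤ κ / (2 * (M + 1)) := min_le_right _ _
  refine ⟨τ, hτ0, hτ1, ?_⟩
  have hid : 324 * (-eStar) * (τ / a₀) ^ 2 = M * τ ^ 2 := by rw [hM]; field_simp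
  rw [hid]
  have hτsq : τ ^ 2 ≤ τ := by nlinarith
  have h1 : M * τ ^ 2 ≤ M * τ := mul_le_mul_of_nonneg_left hτsq hM0
  have h2 : M * τ ≤ M * (κ / (2 * (M + 1))) := mul_le_mul_of_nonneg_left hτ2 hM0
  have h3 : M * (κ / (2 * (M + 1))) < κ := by
    rw [mul_div_assoc', div_lt_iff₀ (by positivity)]
    nlinarith
  linarith

/-! ## §3 Refuted natural strengthenings -/

/-- STRENGTHENING 1 — a price UNIFORM in the tolerance (`∃ κ ∀ τ` instead of `∀ τ ∃ κ`). [folklore] -/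
def UniformKappa : Prop :=
  ∀ δ : ℝ, 0 < δ → ∃ a₀ h₀ : ℝ, InBox a₀ h₀ ∧ ∃ κ : ℝ, 0 < κ ∧
    ∀ τ : ℝ, 0 < τ → τ ≤ 1 → PricingClause δ a₀ h₀ τ κ

/-- **Refuted**: no price uniform in `τ` (dilated ground states, §2). [folklore] -/
theorem not_uniformKappa : ¬ UniformKappa := by
  intro H
  obtain ⟨δ, hδ, hGS⟩ := LennardJonesMinimalDistance_holds
  obtain ⟨a₀, h₀, ⟨ha, -, hh⟩, κ, hκ, hP⟩ := H δ hδ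
  obtain ⟨τ, hτ0, hτ1, hlt⟩ := exists_tau_lt (a₀ := a₀) hκ (by linarith)
  have := kappa_le_of_pricingClause hGS ha hh hτ0 hτ1 (hP τ hτ0 (by linarith))
  linarith

/-- STRENGTHENING 2 — a price LINEAR in the tolerance, `κ(τ) = c·τ` (the shape of the refuted
sitewise predecessor stmt-17253, now in K1's summed clothes). [folklore] -/
def LinearKappa : Prop :=
  ∀ δ : ℝ, 0 < δ → ∃ a₀ h₀ : ℝ, InBox a₀ h₀ ∧ ∃ c : ℝ, 0 < c ∧
    ∀ τ : ℝ, 0 < τ → τ ≤ 1 → PricingClause δ a₀ h₀ τ (c * τ)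

/-- **Refuted**: no linear price (`c τ ≤ 324 (−e⋆) τ²/a₀²` forces `c ≤ O(τ) → 0`). [folklore] -/
theorem not_linearKappa : ¬ LinearKappa := by
  intro H
  obtain ⟨δ, hδ, hGS⟩ := LennardJonesMinimalDistance_holds
  obtain ⟨a₀, h₀, ⟨ha, -, hh⟩, c, hc, hP⟩ := H δ hδ
  have ha0 : 0 < a₀ := by linarith
  set M : ℝ := 324 * (-eStar) / a₀ ^ 2 with hM
  have hM0 : 0 ≤ M := div_nonneg (mul_nonneg (by norm_num) neg_eStar_pos.le) (by positivity)
  set τ : ℝ := min (1 / 20) (c / (2 * (M + 1))) with hτ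
  have hτ0 : 0 < τ := lt_min (by norm_num) (div_pos hc (by positivity))
  have hτ1 : τ ≤ 1 / 20 := min_le_left _ _
  have hτ2 : τ ≤ c / (2 * (M + 1)) := min_le_right _ _
  have hle := kappa_le_of_pricingClause hGS ha hh hτ0 hτ1 (hP τ hτ0 (by linarith))
  have hid : 324 * (-eStar) * (τ / a₀) ^ 2 = M * τ ^ 2 := by rw [hM]; field_simp
  rw [hid] at hle
  -- `c τ ≤ M τ²` gives `c ≤ M τ ≤ M c/(2(M+1)) < c`
  have h1 : c ≤ M * τ := by
    have : c * τ ≤ (M * τ) * τ := by nlinarith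
    exact le_of_mul_le_mul_right this hτ0
  have h2 : M * τ ≤ M * (c / (2 * (M + 1))) := mul_le_mul_of_nonneg_left hτ2 hM0
  have h3 : M * (c / (2 * (M + 1))) < c := by
    rw [mul_div_assoc', div_lt_iff₀ (by positivity)]
    nlinarith
  linarith

/-- The crux with the hypothesis `0 < τ` weakened to `0 ≤ τ` (exact shells priced). [folklore] -/
def SummedShellPricingWithoutTauPos : Prop :=
  ∀ δ : ℝ, 0 < δ → ∃ a₀ h₀ : ℝ, 47 / 50 ≤ a₀ ∧ a₀ ≤ 1 ∧ |h₀ - a₀ * Real.sqrt (2 / 3)| ≤ a₀ / 100 ∧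
    ∀ τ : ℝ, 0 ≤ τ → τ ≤ 1 → ∃ κ : ℝ, 0 < κ ∧ PricingClause δ a₀ h₀ τ κ

/-- **`0 < τ` is load-bearing**: exact-shell pricing (`τ = 0`) is false — finite ground states
are generically NOT exactly Barlow-shelled, and certifiably so after an infinitesimal dilation
(`kappa_nonpos_of_pricingClause_zero`). STRENGTHENING 3 refuted. [folklore] -/
theorem summedShellPricing_false_without_tauPos : ¬ SummedShellPricingWithoutTauPos := by
  intro H
  obtain ⟨δ, hδ, hGS⟩ := LennardJonesMinimalDistance_holds
  obtain ⟨a₀, h₀, ha, -, hh, hP⟩ := H δ hδ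
  obtain ⟨κ, hκ, hP0⟩ := hP 0 le_rfl zero_le_one
  have := kappa_nonpos_of_pricingClause_zero hGS ha hh hP0
  linarith

/-- **Two cells cannot both be priced at one site**: if the reference shells of cell 1 have norms
`≤ 1.01 a₁ < a₂ − 2τ` and `a₂ + τ < 13/10·a₁`, a site `τ`-good for cell `(a₁,h₁)` is `τ`-bad for
cell `(a₂,h₂)` (the point `(a₂,0,0)` of the second reference shell has a preimage of norm
`≥ a₂ − τ`, which lies in the first shell and is therefore of norm `≤ 1.01 a₁ + τ`). [folklore] -/
theorem not_good_of_good_of_cells {a₁ h₁ a₂ h₂ τ : ℝ} (ha₁ : 47 / 50 ≤ a₁)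
    (hh₁ : |h₁ - a₁ * Real.sqrt (2 / 3)| ≤ a₁ / 100) (ha₂ : 0 < a₂)
    (hgap : 101 / 100 * a₁ + 2 * τ < a₂) (hfit : a₂ + τ < 13 / 10 * a₁)
    {N : ℕ} {y : Fin N → E3} {i : Fin N} (hg₁ : Good a₁ h₁ y i τ) : ¬ Good a₂ h₂ y i τ := by
  rintro ⟨A₂, hm₂⟩
  obtain ⟨A₁, hm₁⟩ := hg₁
  have hρ₁ : ∀ p : E3, (p ∈ hcpShell a₁ h₁ ∨ p ∈ fccShell a₁ h₁) → ‖p‖ ≤ 101 / 100 * a₁ :=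
    fun p hp => (norm_le_rho_of_mem ha₁ hh₁ hp).trans (rho_le ha₁ hh₁)
  -- from the second matching: a shell point `t` with `a₂ - τ ≤ ‖t - y i‖ ≤ a₂ + τ`
  have key₂ : ∀ T : Set E3, (∃ p ∈ T, ‖p‖ = a₂) → MatchedTo a₂ y i T A₂ τ →
      ∃ t : E3, t ∈ Set.range y ∧ t ≠ y i ∧ a₂ - τ ≤ ‖t - y i‖ ∧ ‖t - y i‖ ≤ a₂ + τ := by
    rintro T ⟨p₀, hp₀, hn⟩ ⟨e, he⟩
    have h1 : dist ((e.symm ⟨p₀, hp₀⟩ : E3) - y i) (A₂ p₀) ≤ τ := by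
      simpa using he (e.symm ⟨p₀, hp₀⟩)
    rw [dist_eq_norm] at h1
    have hAp : ‖A₂ p₀‖ = a₂ := by rw [LinearIsometry.norm_map, hn]
    obtain ⟨hr, hne, -⟩ := (e.symm ⟨p₀, hp₀⟩).2
    refine ⟨_, hr, hne, ?_, ?_⟩
    · have h2 := norm_sub_norm_le (A₂ p₀) ((e.symm ⟨p₀, hp₀⟩ : E3) - y i)
      have h3 : ‖A₂ p₀ - ((e.symm ⟨p₀, hp₀⟩ : E3) - y i)‖ = ‖(e.symm ⟨p₀, hp₀⟩ : E3) - y i - A₂ p₀‖ :=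
        norm_sub_rev _ _
      linarith
    · have h2 := norm_sub_norm_le ((e.symm ⟨p₀, hp₀⟩ : E3) - y i) (A₂ p₀)
      linarith
  -- from the first matching: every point of the first shell has `‖t - y i‖ ≤ 1.01 a₁ + τ`
  have key₁ : ∀ T : Set E3, (∀ p ∈ T, ‖p‖ ≤ 101 / 100 * a₁) → MatchedTo a₁ y i T A₁ τ →
      ∀ t : ↥(shell a₁ y i), ‖(t : E3) - y i‖ ≤ 101 / 100 * a₁ + τ := by
    rintro T hT ⟨e, he⟩ t
    have h1 := he t
    rw [dist_eq_norm] at h1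
    have h2 : ‖A₁ ((e t : ↥T) : E3)‖ ≤ 101 / 100 * a₁ := by
      rw [LinearIsometry.norm_map]; exact hT _ (e t).2
    have h3 := norm_sub_norm_le ((t : E3) - y i) (A₁ ((e t : ↥T) : E3))
    linarith
  obtain ⟨t, hr, hne, hlo, hhi⟩ : ∃ t : E3, t ∈ Set.range y ∧ t ≠ y i ∧
      a₂ - τ ≤ ‖t - y i‖ ∧ ‖t - y i‖ ≤ a₂ + τ := by
    rcases hm₂ with hm | hm
    · exact key₂ _ (exists_mem_norm_eq_a ha₂ alternatingHagg) hm
    · exact key₂ _ (exists_mem_norm_eq_a ha₂ constHagg) hm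
  have ht : t ∈ shell a₁ y i := ⟨hr, hne, by rw [dist_eq_norm]; linarith⟩
  have hup : ‖t - y i‖ ≤ 101 / 100 * a₁ + τ := by
    rcases hm₁ with hm | hm
    · exact key₁ _ (fun p hp => hρ₁ p (Or.inl hp)) hm ⟨t, ht⟩
    · exact key₁ _ (fun p hp => hρ₁ p (Or.inr hp)) hm ⟨t, ht⟩
  linarith

/-- **Two cells cannot both satisfy the pricing clause** (at any positive prices): the ground
states would have to be `τ`-good at almost every site for BOTH, and no site is good for both.
[folklore] -/
theorem not_pricingClause_two_cells {δ : ℝ}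
    (hδGS : ∀ (N : ℕ) (x : Fin N → E3), IsGroundState lennardJones x →
      ∀ i j : Fin N, i ≠ j → δ ≤ dist (x i) (x j))
    {a₁ h₁ a₂ h₂ τ κ₁ κ₂ : ℝ} (ha₁ : 47 / 50 ≤ a₁) (hh₁ : |h₁ - a₁ * Real.sqrt (2 / 3)| ≤ a₁ / 100)
    (ha₂ : 0 < a₂) (hgap : 101 / 100 * a₁ + 2 * τ < a₂) (hfit : a₂ + τ < 13 / 10 * a₁)
    (hκ₁ : 0 < κ₁) (hκ₂ : 0 < κ₂)
    (hP₁ : PricingClause δ a₁ h₁ τ κ₁) (hP₂ : PricingClause δ a₂ h₂ τ κ₂) : False := by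
  classical
  set m : ℝ := min κ₁ κ₂ with hm
  have hm0 : 0 < m := lt_min hκ₁ hκ₂
  have hm1 : m ≤ κ₁ := min_le_left _ _
  have hm2 : m ≤ κ₂ := min_le_right _ _
  set θ : ℝ := m / 4 with hθ
  have hθ0 : 0 < θ := by positivity
  have hEL : Filter.Tendsto (fun N : ℕ => groundStateEnergy lennardJones 3 N / (N : ℝ)) Filter.atTop
      (nhds eStar) := crysEnergyLimit
  have hev1 : ∀ᶠ N : ℕ in Filter.atTop, groundStateEnergy lennardJones 3 N / (N : ℝ) < eStar + θ :=
    (tendsto_order.1 hEL).2 _ (lt_add_of_pos_right _ hθ0)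
  obtain ⟨N, hN1, hN3⟩ := (hev1.and (Filter.eventually_ge_atTop 1)).exists
  have hNpos : (0 : ℝ) < N := by exact_mod_cast hN3
  have hEup : groundStateEnergy lennardJones 3 N < (eStar + θ) * N := (div_lt_iff₀ hNpos).1 hN1
  obtain ⟨x, hx⟩ := LennardJonesGroundStatesExist_holds N
  have hsep := hδGS N x hx
  set B₁ : Finset (Fin N) := Finset.univ.filter (fun i : Fin N => ¬ Good a₁ h₁ x i τ) with hB₁
  set B₂ : Finset (Fin N) := Finset.univ.filter (fun i : Fin N => ¬ Good a₂ h₂ x i τ) with hB₂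
  have hS1 := hP₁ N x hsep B₁ (fun i hi => (Finset.mem_filter.1 hi).2)
  have hS2 := hP₂ N x hsep B₂ (fun i hi => (Finset.mem_filter.1 hi).2)
  rw [hx.2] at hS1 hS2
  have hcover : (Finset.univ : Finset (Fin N)) ⊆ B₁ ∪ B₂ := by
    intro i _
    rw [Finset.mem_union, hB₁, hB₂, Finset.mem_filter, Finset.mem_filter]
    by_cases hg : Good a₁ h₁ x i τ
    · exact Or.inr ⟨Finset.mem_univ _, not_good_of_good_of_cells ha₁ hh₁ ha₂ hgap hfit hg⟩
    · exact Or.inl ⟨Finset.mem_univ _, hg⟩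
  have hcount : (N : ℝ) ≤ (B₁.card : ℝ) + (B₂.card : ℝ) := by
    have h1 := (Finset.card_le_card hcover).trans (Finset.card_union_le _ _)
    rw [Finset.card_univ, Fintype.card_fin] at h1
    exact_mod_cast h1
  have hb1 : m * (B₁.card : ℝ) ≤ κ₁ * (B₁.card : ℝ) := mul_le_mul_of_nonneg_right hm1 (Nat.cast_nonneg _)
  have hb2 : m * (B₂.card : ℝ) ≤ κ₂ * (B₂.card : ℝ) := mul_le_mul_of_nonneg_right hm2 (Nat.cast_nonneg _)
  have hsum : m * (N : ℝ) < 2 * θ * N := by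
    have := mul_le_mul_of_nonneg_left hcount hm0.le
    nlinarith [this, hb1, hb2, hS1, hS2, hEup]
  have : m < 2 * θ := lt_of_mul_lt_mul_right hsum hNpos.le
  rw [hθ] at this
  linarith

/-- STRENGTHENING 4 — the crux for EVERY cell of the box (`∀ a₀ h₀` instead of `∃ a₀ h₀`). [folklore] -/
def SummedShellPricingForallCells : Prop :=
  ∀ δ : ℝ, 0 < δ → ∀ a₀ h₀ : ℝ, 47 / 50 ≤ a₀ → a₀ ≤ 1 → |h₀ - a₀ * Real.sqrt (2 / 3)| ≤ a₀ / 100 →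
    ∀ τ : ℝ, 0 < τ → τ ≤ 1 → ∃ κ : ℝ, 0 < κ ∧ PricingClause δ a₀ h₀ τ κ

/-- **Refuted: the cell is pinned, not free.**  The ideal cells `(47/50, 47/50·√(2/3))` and
`(1, √(2/3))` (both in the box) cannot both be priced at `τ = 1/50`
(`not_pricingClause_two_cells`).  So any proof of K1 must IDENTIFY the cell from the ground states
(it is forced to be their asymptotic first-shell cell, `card_bad_le_of_pricingClause`); K1 is not
soft in `(a₀, h₀)`. [folklore] -/
theorem not_summedShellPricing_forall_cells : ¬ SummedShellPricingForallCells := by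
  intro H
  obtain ⟨δ, hδ, hGS⟩ := LennardJonesMinimalDistance_holds
  have hb₁ : |47 / 50 * Real.sqrt (2 / 3) - 47 / 50 * Real.sqrt (2 / 3)| ≤ (47 / 50 : ℝ) / 100 := by
    rw [sub_self, abs_zero]; norm_num
  have hb₂ : |Real.sqrt (2 / 3) - 1 * Real.sqrt (2 / 3)| ≤ (1 : ℝ) / 100 := by
    rw [one_mul, sub_self, abs_zero]; norm_num
  obtain ⟨κ₁, hκ₁, hP₁⟩ := H δ hδ (47 / 50) (47 / 50 * Real.sqrt (2 / 3)) le_rfl (by norm_num) hb₁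
    (1 / 50) (by norm_num) (by norm_num)
  obtain ⟨κ₂, hκ₂, hP₂⟩ := H δ hδ 1 (Real.sqrt (2 / 3)) (by norm_num) le_rfl hb₂
    (1 / 50) (by norm_num) (by norm_num)
  exact not_pricingClause_two_cells hGS le_rfl hb₁ one_pos (by norm_num) (by norm_num) hκ₁ hκ₂ hP₁ hP₂

/-! ## §4 Load-bearing hypotheses -/

/-- The crux with the restriction `B ⊆ bad` DROPPED (every site priced). [folklore] -/
def SummedShellPricingWithoutBad : Prop :=
  ∀ δ : ℝ, 0 < δ → ∃ a₀ h₀ : ℝ, 47 / 50 ≤ a₀ ∧ a₀ ≤ 1 ∧ |h₀ - a₀ * Real.sqrt (2 / 3)| ≤ a₀ / 100 ∧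
    ∀ τ : ℝ, 0 < τ → τ ≤ 1 → ∃ κ : ℝ, 0 < κ ∧
      ∀ (N : ℕ) (y : Fin N → E3), (∀ i j : Fin N, i ≠ j → δ ≤ dist (y i) (y j)) →
        ∀ B : Finset (Fin N), κ * (B.card : ℝ) ≤ interactionEnergy lennardJones y - (N : ℝ) * eStar

/-- **`B ⊆ bad` is load-bearing**: the excess of ground states is `o(N)`, so no extensive set of
sites can be priced. [folklore] -/
theorem summedShellPricing_false_without_bad : ¬ SummedShellPricingWithoutBad := by
  intro H
  obtain ⟨δ, hδ, hGS⟩ := LennardJonesMinimalDistance_holds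
  obtain ⟨a₀, h₀, -, -, -, hP⟩ := H δ hδ
  obtain ⟨κ, hκ, hP1⟩ := hP 1 one_pos le_rfl
  have hEL : Filter.Tendsto (fun N : ℕ => groundStateEnergy lennardJones 3 N / (N : ℝ)) Filter.atTop
      (nhds eStar) := crysEnergyLimit
  have hev1 : ∀ᶠ N : ℕ in Filter.atTop, groundStateEnergy lennardJones 3 N / (N : ℝ) < eStar + κ / 2 :=
    (tendsto_order.1 hEL).2 _ (lt_add_of_pos_right _ (half_pos hκ))
  obtain ⟨N, hN1, hN3⟩ := (hev1.and (Filter.eventually_ge_atTop 1)).exists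
  have hNpos : (0 : ℝ) < N := by exact_mod_cast hN3
  have hEup : groundStateEnergy lennardJones 3 N < (eStar + κ / 2) * N := (div_lt_iff₀ hNpos).1 hN1
  obtain ⟨x, hx⟩ := LennardJonesGroundStatesExist_holds N
  have h := hP1 N x (hGS N x hx) Finset.univ
  rw [Finset.card_univ, Fintype.card_fin, hx.2] at h
  nlinarith

/-- The crux with the separation hypothesis DROPPED ENTIRELY (`y` arbitrary, possibly with
coincident points; the `∀ δ` prefix then binds nothing and is omitted). [folklore] -/
def SummedShellPricingWithoutSeparation : Prop :=
  ∃ a₀ h₀ : ℝ, 47 / 50 ≤ a₀ ∧ a₀ ≤ 1 ∧ |h₀ - a₀ * Real.sqrt (2 / 3)| ≤ a₀ / 100 ∧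
    ∀ τ : ℝ, 0 < τ → τ ≤ 1 → ∃ κ : ℝ, 0 < κ ∧
      ∀ (N : ℕ) (y : Fin N → E3) (B : Finset (Fin N)), (∀ i ∈ B, ¬ Good a₀ h₀ y i τ) →
        κ * (B.card : ℝ) ≤ interactionEnergy lennardJones y - (N : ℝ) * eStar

/-- **Separation (or at least injectivity) is load-bearing — but only through the junk value
`V_LJ(0) = 0`**: the DOUBLED ground state `x ⧺ x` (every point twice) has energy `4 E(N)` (the `N`
coincident pairs contribute `V(0) = 0` instead of `+∞`) against the floor `2N e⋆`, and
`4 E(N) − 2N e⋆ → 2N e⋆ < 0`; already `B = ∅` fails.  (The honest reading — injective but not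
separated — is believed EQUIVALENT to K1: the landed `stub_sepReduction` removes separation down to
every `δ > 0` by closest-pair deletion, and the same deletion handles merely injective `y`.)
[folklore] -/
theorem summedShellPricing_false_without_separation : ¬ SummedShellPricingWithoutSeparation := by
  rintro ⟨a₀, h₀, -, -, -, hP⟩
  obtain ⟨κ, -, hP1⟩ := hP 1 one_pos le_rfl
  have he : 0 < -eStar := neg_eStar_pos
  have hEL : Filter.Tendsto (fun N : ℕ => groundStateEnergy lennardJones 3 N / (N : ℝ)) Filter.atTop
      (nhds eStar) := crysEnergyLimit
  have hev1 : ∀ᶠ N : ℕ in Filter.atTop,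
      groundStateEnergy lennardJones 3 N / (N : ℝ) < eStar + (-eStar / 4) :=
    (tendsto_order.1 hEL).2 _ (lt_add_of_pos_right _ (by positivity))
  obtain ⟨N, hN1, hN3⟩ := (hev1.and (Filter.eventually_ge_atTop 1)).exists
  have hNpos : (0 : ℝ) < N := by exact_mod_cast hN3
  have hEup : groundStateEnergy lennardJones 3 N < (eStar + (-eStar / 4)) * N := (div_lt_iff₀ hNpos).1 hN1
  obtain ⟨x, hx⟩ := LennardJonesGroundStatesExist_holds N
  have h := hP1 (N + N) (Fin.append x x) ∅ (fun i hi => absurd hi (Finset.notMem_empty i))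
  rw [Finset.card_empty, Nat.cast_zero, mul_zero, interactionEnergy_append lennardJones lennardJones_zero,
    ← two_mul_interactionEnergy_eq_sum_sum lennardJones lennardJones_zero, hx.2] at h
  push_cast at h
  nlinarith

/-- The crux with the upper bound `τ ≤ 1` DROPPED (every positive tolerance). [folklore] -/
def SummedShellPricingNoUpperTau : Prop :=
  ∀ δ : ℝ, 0 < δ → ∃ a₀ h₀ : ℝ, 47 / 50 ≤ a₀ ∧ a₀ ≤ 1 ∧ |h₀ - a₀ * Real.sqrt (2 / 3)| ≤ a₀ / 100 ∧
    ∀ τ : ℝ, 0 < τ → ∃ κ : ℝ, 0 < κ ∧ PricingClause δ a₀ h₀ τ κ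

/-- **`τ ≤ 1` is NOT load-bearing** (cosmetic): goodness is an up-set in `τ`, so `κ(1)` serves every
`τ > 1`. Likewise `∀ δ > 0` may be replaced by `δ = 1/3` (landed `stub_sepReduction`, p166632).
[folklore] -/
theorem summedShellPricing_iff_noUpperTau : SummedShellPricing ↔ SummedShellPricingNoUpperTau := by
  rw [summedShellPricing_iff]
  constructor
  · intro H δ hδ
    obtain ⟨a₀, h₀, ha, ha', hh, hP⟩ := H δ hδ
    refine ⟨a₀, h₀, ha, ha', hh, fun τ hτ => ?_⟩
    rcases le_or_gt τ 1 with h1 | h1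
    · exact hP τ hτ h1
    · obtain ⟨κ, hκ, hP1⟩ := hP 1 one_pos le_rfl
      exact ⟨κ, hκ, pricingClause_mono_tau h1.le hP1⟩
  · intro H δ hδ
    obtain ⟨a₀, h₀, ha, ha', hh, hP⟩ := H δ hδ
    exact ⟨a₀, h₀, ha, ha', hh, fun τ hτ _ => hP τ hτ⟩

/-! ## §5 What K1 forces on the ground states (a positive consequence, for provers) -/

/-- **K1 at a cell `c` contains first-shell crystallization onto `c`**: if the pricing clause holds
at `(a₀, h₀, τ)` with some `κ > 0` (and ground states are `δ`-separated), then for every `ε > 0`,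
eventually in `N`, every ground state has at most `ε N` sites whose `13/10·a₀`-shell is not
`τ`-matched to the hcp/fcc 12-shell of THAT cell.  With `not_summedShellPricing_forall_cells`: the
`∃ (a₀,h₀)` of K1 can only be the exact asymptotic cell of the Lennard-Jones ground states, for
every `τ` simultaneously — so a proof of K1 proves in passing that such a cell exists (one in-layer
spacing, ONE interlayer gap serving both letters). [folklore] -/
theorem card_bad_le_of_pricingClause {δ : ℝ}
    (hδGS : ∀ (N : ℕ) (x : Fin N → E3), IsGroundState lennardJones x →
      ∀ i j : Fin N, i ≠ j → δ ≤ dist (x i) (x j))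
    {a₀ h₀ τ κ : ℝ} (hκ : 0 < κ) (hP : PricingClause δ a₀ h₀ τ κ) {ε : ℝ} (hε : 0 < ε) :
    ∀ᶠ N : ℕ in Filter.atTop, ∀ x : Fin N → E3, IsGroundState lennardJones x →
      ∀ B : Finset (Fin N), (∀ i ∈ B, ¬ Good a₀ h₀ x i τ) → (B.card : ℝ) ≤ ε * N := by
  have hEL : Filter.Tendsto (fun N : ℕ => groundStateEnergy lennardJones 3 N / (N : ℝ)) Filter.atTop
      (nhds eStar) := crysEnergyLimit
  have hev1 : ∀ᶠ N : ℕ in Filter.atTop, groundStateEnergy lennardJones 3 N / (N : ℝ) < eStar + κ * ε :=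
    (tendsto_order.1 hEL).2 _ (lt_add_of_pos_right _ (mul_pos hκ hε))
  filter_upwards [hev1, Filter.eventually_ge_atTop 1] with N hN1 hN3 x hx B hB
  have hNpos : (0 : ℝ) < N := by exact_mod_cast hN3
  have hEup : groundStateEnergy lennardJones 3 N < (eStar + κ * ε) * N := (div_lt_iff₀ hNpos).1 hN1
  have h := hP N x (hδGS N x hx) B hB
  rw [hx.2] at h
  have hlt : κ * (B.card : ℝ) < κ * (ε * N) := by nlinarith
  exact (lt_of_mul_lt_mul_left hlt hκ.le).le

/-! ## §6 Line `Sketch` (lead prover-line-stmt-AtomisticToContinuum-17044-0) and near-misses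

STATUS OF THE STUBS (read 2026-08-17T14:40Z from the item record): `stub_torusGlue` (p166291),
`stub_periodisation` (p166315), `stub_blocksConverse` (p166619), `stub_sepReduction` (p166632) are
LANDED — so K1 ⇔ its torus form at `δ = 1/3`, kernel-checked.  Open: `stub_coerciveTwoShellGap`
(= hub crux stmt-13956, own line and own disprover; not attacked here — anti-leakage) and the core
`stub_torusCoercivity`.

`stub_torusCoercivity` VERSUS THE LEVERS OF THIS FILE.  Every witness above is a ground state or its
dilate, about whose GEOMETRY the tree knows nothing; the stub carries an allowance
`− C·#{1/20-two-shell-bad motif points}` with `C ≥ 0` free, and nothing prevents (in the tree) a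
ground state from being two-shell-bad at EVERY site, in which case the stub's inequality reads
`c·0 − C·N ≤ N·(e(P) − e⋆)` — true for `C ≥ −(e(P) − e⋆)`, i.e. vacuous on the only configurations
we control.  Hence NO analogue of §2–§3 is certifiable against `stub_torusCoercivity` (not even the
`O(τ²)` tightness of `c(τ)`), short of a configuration that is provably two-shell-good in the bulk AND
provably within `c·ρ_bad` of `e⋆` — i.e. short of knowing `e⋆ = e(relaxed hcp)` to `7·10⁻⁵`.
The joint sufficiency `SummedShellPricing_of` is kernel-checked (no smuggled gap); the reduction is
honest: K1 ⇒ torusCoercivity with `C = 0` (blocksConverse), so the core is EQUIVALENT to K1 modulo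
the hub crux, not easier.

NEAR-MISSES / NOT ATTEMPTED (and why):
* hcp-ONLY shells (drop the fcc disjunct): believed STILL TRUE (fcc bulk costs `7.2e-5`/site,
  c-layers of faulted hcp ground states have density `→ 0`); fcc-ONLY: believed FALSE (hcp bulk);
  neither is certifiable (needs the sign of `e(fcc) − e(hcp)` with the full tail AND `e⋆ = e(hcp)`).
* a SECOND interlayer gap (`h₁ ≠ h₂` above/below): the route's own kill criterion (relaxed
  4H/6H/9R bulk); for the untruncated `r⁻¹²/12 − r⁻⁶/6` the ANNNI-type layer expansion has
  `δ₂ ≫ δ₃ > 0` (eclipsed-vs-shifted contrast at layer distance `n`, decaying like `e^{−|G₁| n h}`),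
  so hcp beats every other Hägg word before relaxation and polytypes win only under truncation
  (PartayOrtnerCsanyi2017, LoachAckland2017) — no witness exists numerically, none is certifiable.
* coordination ≠ 12 witnesses (vacancies, compression past `√2·a/1.3`): cost `O(1)` per bad site
  (numerics: vacancy 5.9e-2, interstitial ≥ 1e-2 per bad shell) — consistent with `∀ τ ∃ κ`.
* the binding quadratic family (one displaced atom, `κ(τ) ≲ 1.4 τ²`, ideator numerics j024711) is
  sharper than §2's `324(−e⋆)(τ/a₀)² ≈ 250 τ²` but not certifiable (needs the local phonon
  curvature of a ground state).
-/

end Summit.AtomisticToContinuum.Crystallization.Cruxes.SummedShellPricing.Disproof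

end
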